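import Summits.QuantumFields.BalabanUV.Gaps.D4FromNE5Activities
import Literature.MathematicalPhysics.QuantumFieldTheory.Balaban1983to89.Beta.RemainderDecay190SectG

/-!
# `BalabanUV.Beta.RemainderEndActivitiesSectG` — (D4) at one (k, p) with NODE D SUPPLIED BY [15] SECT. G: NE5-type H-layer
# activities ∧ Bałaban's (179)–(180) scheme data per torus ∧ the (4.4)-dictionary and (1.7)-limit letters ⟹ `|β¹_{k+1}(p)| ≤ ε₁K`,
# NO `Data190` binder left (unit `b2b-balaban-beta-an4` gen 89, BINDER row D4 OWNER)

HONEST FRAMING (cell rule, page 1).  WHAT THIS IS: ONE composition BY NAME, kernel-checked — the gaps cell's consumer-side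
junction `Gaps.D4FromNE5Activities.abs_beta1_le_of_activities_at` (NE5 activities ⟹ (D4) at (k, p), which still takes the
(190)-socket `D : Data190 4 M N Wn q` as ONE abstract binder) with that binder FILLED by the row-D4 owner's NODE D join
`Beta.RemainderDecay190SectG.h190_of_sectG_actual` (p349127): on every torus the first B-derivative of the (179) chart
`dHn n := (fderiv ℂ (chartH179 (𝒢 n) (Wv n) (D2 n) (H₀ n) (· − H n (Dm n ·)) (ε₄ n)) (B n)).restrictScalars ℝ` with (190) from
the located leaves of [15] Sect. G at O(1) letters COMMON to all tori, plus the (4.4)-dictionary letters.  So the statement below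
lists, in one place, EVERY hypothesis under which the tree derives (D4) at one scale k and history p — and none of them is a
`Data190`, a `PolLeavesTFac190H` or a `StepObjectD4`: they are NE5's activity record, Bałaban's Sect. G operators AS PARAMETERS
(NODE O), the located leaves of print ((189) author-omitted, cell GAPS G-B11-G2; kernel letters; Lemma 2.1 [3]; (2.54); q < 1),
the (T12) dictionary letters, the (1.7)/(1.21) limit letters, the (1.22) identification and the numerics N1–N2.  WHAT THIS IS NOT:
not an instance (nothing of Bałaban's is constructed; instance count of row (D4) 0∕1 unchanged), not (D4) (one (k, p), all
objects hypotheses), not Lemma 3, not (190); NOT B12 Thm 2, NOT `BetaPertH`, NOT the continuum limit, NOT Clay.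
HONEST DEPENDENCY (verbatim): continuum YM on T⁴ ⇐ BetaPertH ∧ nine spine estimates (0/9 proved); BetaPertH ⇐ (D1) ∧ (D4)
∧ CAP+tail; G-an2-4 gates asym, D1 and NE2/3/4.

Provenance: an4 gen 89 (2026-08-23); imports `Gaps.D4FromNE5Activities` (g1-p2, p344392) + `Beta.RemainderDecay190SectG` (an4,
p349127) only; no `def`, no new hypothesis shape, 0 sorry, axioms standard; nothing existing modified.  [cite tags are CONTEXT.]
-/

namespace Summit.QuantumFields.BalabanUV.Beta.RemainderEndActivitiesSectG

open Filter Metric Set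
open scoped Topology
open Literature.MathematicalPhysics.QuantumFieldTheory.Balaban1983to89
open FlowStep B11SectG B6RandomWalk B11Eq174Chart B11Eq183Differentiation
open Literature.MathematicalPhysics.QuantumFieldTheory.Balaban1983to89.TreeLengthTorus (TPt TDom proj tsys torusTreeLen)
open Literature.MathematicalPhysics.QuantumFieldTheory.Balaban1983to89.B13ScaleTransfer (Pt)
open Literature.MathematicalPhysics.QuantumFieldTheory.Balaban1983to89.Beta.RemainderChainLattice (CondsL SignsL remCoeffL)
open Literature.MathematicalPhysics.QuantumFieldTheory.Balaban1983to89.Beta.RemainderLimitTorus (LDom limKernel tproj)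
open Literature.MathematicalPhysics.QuantumFieldTheory.Balaban1983to89.Beta.RemainderDecay190 (Consts190 Data190)
open Literature.MathematicalPhysics.QuantumFieldTheory.Balaban1983to89.Beta.RemainderDecay190SectG (h190_of_sectG_actual)
open Literature.MathematicalPhysics.QuantumFieldTheory.Balaban1983to89.B12Decay510 (mixedDeriv)
open Literature.MathematicalPhysics.QuantumFieldTheory.Balaban1983to89.B12Decay510FromB11 (NormDominated UnitFieldsLocalised)
open Literature.MathematicalPhysics.QuantumFieldTheory.Balaban1983to89.B12Decay510Torus (geomT)
open Summit.QuantumFields.BalabanUV.T4Continuum.Spine.NE5 (stepObjectOfActivities)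
open Summit.QuantumFields.BalabanUV.Gaps.D4FromNE5Activities (abs_beta1_le_of_activities_at)

variable {M : ℕ} [NeZero M] {μ ν : Fin 4} {β : HBeta} {Sβ : B12Beta.OneLoopSplit β} {c : B13.Consts} {ℓ α₂ : ℝ}
  {q : Consts190}
variable {Op Hist : Type*} [NormedAddCommGroup Op] [NormedSpace ℂ Op] [NormedAddCommGroup Hist] [NormedSpace ℂ Hist]
variable {I : Type} {gn : ℕ → B6.Geometry} {𝒳 𝒴 𝒵 : ℕ → Type} [∀ n, NormedAddCommGroup (𝒳 n)] [∀ n, NormedSpace ℂ (𝒳 n)]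
  [∀ n, NormedAddCommGroup (𝒴 n)] [∀ n, NormedSpace ℂ (𝒴 n)] [∀ n, NormedAddCommGroup (𝒵 n)] [∀ n, NormedSpace ℂ (𝒵 n)]
  [∀ n, CompleteSpace (𝒳 n)] [∀ n, CompleteSpace (𝒴 n)] [∀ n, CompleteSpace (𝒵 n)]

/-- **(D4) AT ONE (k, p), NODE D SUPPLIED BY [15] SECT. G — no `Data190` binder.**  Hypotheses, grouped: (NE5) exhausting tori
`N n → ∞`, configuration types `Φ n` with data maps `dat n`, activities `act n` ℂ-differentiable on `V n` with the Lemma-3 majorant,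
the (4.4)-spaces `Wn n` with seams `s n X` into the α₂-ball staying in `V n` — verbatim from `abs_beta1_le_of_activities_at`;
(NODE D ∕ O.2) on the n-th torus Bałaban's (179)–(180) data in `B11Eq183Differentiation`'s scheme — B-data `𝒳 n`, the space
(115) `𝒴 n`, `𝒵 n`, G̃ `𝒢 n`, W = (δ/δA′)V `Wv n`, Δ⁽²⁾ `D2 n`, H₀, H, the Sect. C map `Dm n` with derivative `𝔇 n`, regime,
domain point `B n` — with block sizes `bB n`, `bN n`, `b3 n`, `bout n i` over a multiscale geometry `gn n` ((2.54), d ≥ 0),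
size/norm letters, cutting constants ≤ `q.κB`, κ̄_N, κ̄₃, the located letters (189), G̃, Δ⁽²⁾H₀, H₀, H, 𝔇 with O(1) letters and
rate δ₀ COMMON to all tori, the row sum (2.61) at `q.σ ≤ ⅛δ₀` with constant `q.cR`, `qG κ̄₃ κ̄_N B_G θ_W q.cR < 1`, `q.Cst` ≥
the written-out O(1), `q.δ15 ≤ δ₀`; (T12 dictionary) blocks `blk n X̄`, identification `ι n X̄ : 𝒴 n → Wn n` dominated by the
local sizes, unit source fields `u n x` of B-size ≤ `q.m` localised with factor `q.θ`; (NODE E) the (1.7)-factorization through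
torus-independent `Vsp Y`, `F Y`, restriction maps `r n Y`, and the convergence of the restricted test vectors
`r n Y (ι n Y ((δ𝓗_n)(u n x)))` to `t Y x`; the read-out `a`; the (1.22) identification; `CondsL`, `R22gen`, `q.Valid c.δ₀`,
`SignsL`.  CONCLUSION: `|Sβ.β1 k p| ≤ c.ε₁ · remCoeffL 4 M c α₂ q.B₃`.  Proof: `abs_beta1_le_of_activities_at` at the `Data190`
literal whose `dHn` is the actual derivative and whose `h190` is `h190_of_sectG_actual`.  Every input a hypothesis; instance 0∕1.
[cite: Balaban1987RG1, (1.22) p.264, (4.4) p.281, p.282; Balaban1985Variational, (179)-(190) pp.306-308; Balaban1988RG2Cluster, Lemma 3 (2.38) p.20] -/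
theorem abs_beta1_le_of_activities_sectG_at {k : ℕ} {p : Fin (k + 1) → ℝ}
    (N : ℕ → ℕ) [hN : ∀ n, NeZero (N n)] (hNlim : Tendsto N atTop atTop)
    (Φ : ℕ → Type) (dat : (n : ℕ) → Φ n → Op × Hist) (act : (n : ℕ) → Op × Hist → TDom 4 (N n) → ℂ)
    (V : ℕ → Set (Op × Hist))
    (hmaj : ∀ n, ∀ z ∈ V n, ∀ Z : TDom 4 (N n),
      ‖act n z Z‖ ≤ c.C3act * c.ε₁ * Real.exp (-((1 - 8 * c.δ) * ℓ * c.κ * torusTreeLen Z.1)))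
    (hhol : ∀ n, ∀ Z : TDom 4 (N n), DifferentiableOn ℂ (fun z : Op × Hist => act n z Z) (V n))
    (Wn : ℕ → Type) [instW : ∀ n, NormedAddCommGroup (Wn n)] [instWs : ∀ n, NormedSpace ℂ (Wn n)]
    (s : (n : ℕ) → TDom 4 (N n) → Wn n → Φ n)
    (hs : ∀ n X, DifferentiableOn ℂ (fun v => dat n (s n X v)) (ball 0 α₂))
    (hmaps : ∀ n X, MapsTo (fun v => dat n (s n X v)) (ball 0 α₂) (V n))
    -- NODE D from [15] Sect. G: Bałaban's (179)–(180) scheme data per torus (parameters), block sizes, located letters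
    (𝒢 : (n : ℕ) → 𝒵 n →L[ℂ] 𝒴 n) (Wv : (n : ℕ) → 𝒴 n → 𝒵 n)
    (D2 : (n : ℕ) → 𝒴 n →L[ℂ] 𝒵 n) (H₀ H : (n : ℕ) → 𝒳 n →L[ℂ] 𝒴 n) (Dm : (n : ℕ) → 𝒴 n → 𝒳 n)
    (𝔇 : (n : ℕ) → 𝒴 n →L[ℂ] 𝒳 n) (B₀ θ C₄ a₃ jR aR ε₄ : ℕ → ℝ) (B : (n : ℕ) → 𝒳 n)
    (R : ∀ n, Regime (𝒢 n) 0 (Wv n) (B₀ n) (θ n) (C₄ n) (a₃ n) (jR n) (aR n) (ε₄ n))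
    (hWa : ∀ n, AnalyticOnNhd ℂ (Wv n) {Y : 𝒴 n | ‖Y‖ < a₃ n})
    (hJ : ∀ n, ‖D2 n (H₀ n (B n))‖ < jR n) (h𝔄 : ∀ n, ‖H₀ n (B n)‖ < aR n)
    (hD : ∀ n, HasFDerivAt (Dm n) (𝔇 n) (solA180 (𝒢 n) (Wv n) (D2 n) (H₀ n) (ε₄ n) (B n) + H₀ n (B n)))
    (bB : (n : ℕ) → BlockNorm (gn n) (𝒳 n)) (bN : (n : ℕ) → BlockNorm (gn n) (𝒴 n))
    (b3 : (n : ℕ) → BlockNorm (gn n) (𝒵 n)) (bout : (n : ℕ) → I → BlockNorm (gn n) (𝒴 n))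
    (hNsz : ∀ n (y : (gn n).Site) (v : 𝒴 n), (bN n).loc y v ≤ ‖v‖)
    (hBloc : ∀ n (y' : (gn n).Site) (m : 𝒳 n), (bB n).IsLoc y' m → ‖m‖ ≤ (bB n).loc y' m)
    (blk : (n : ℕ) → TDom 4 (N n) → Finset (gn n).Site) (ι : (n : ℕ) → TDom 4 (N n) → 𝒴 n → Wn n)
    (u : (n : ℕ) → TPt 4 (N n * M) → 𝒳 n)
    {δ₀ BG BG₂ θW cΔ A₀ A₀₂ AH₂ θD κN κ₃ : ℝ}
    (htri : ∀ n, Triangle254 (gn n)) (hd : ∀ n (y y' : (gn n).Site), 0 ≤ (gn n).dist y y') (hδ₀ : 0 ≤ δ₀)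
    (hrow : ∀ n, RowSum (gn n) q.σ q.cR) (hσ : q.σ ≤ δ₀ / 8)
    (hBG : 0 ≤ BG) (hBG₂ : 0 ≤ BG₂) (hθW : 0 ≤ θW) (hcΔ : 0 ≤ cΔ) (hA₀ : 0 ≤ A₀) (hA₀₂ : 0 ≤ A₀₂)
    (hAH₂ : 0 ≤ AH₂) (hθD : 0 ≤ θD)
    (hκB : ∀ n, (bB n).κ ≤ q.κB) (hκN : ∀ n, (bN n).κ ≤ κN) (hκ₃ : ∀ n, (b3 n).κ ≤ κ₃)
    (hG : ∀ n, HasMaj (b3 n) (bN n) ((𝒢 n).restrictScalars ℝ : 𝒵 n →ₗ[ℝ] 𝒴 n)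
      (fun y y' => BG * Real.exp (-(δ₀ * (gn n).dist y y'))))
    (hG₂ : ∀ n i, HasMaj (b3 n) (bout n i) ((𝒢 n).restrictScalars ℝ : 𝒵 n →ₗ[ℝ] 𝒴 n)
      (fun y y' => BG₂ * Real.exp (-(δ₀ * (gn n).dist y y'))))
    (h189 : ∀ n, Ineq189 (bN n) (b3 n)
      ((fderiv ℂ (Wv n) (solA180 (𝒢 n) (Wv n) (D2 n) (H₀ n) (ε₄ n) (B n) + H₀ n (B n))).restrictScalars ℝ :
        𝒴 n →ₗ[ℝ] 𝒵 n) θW δ₀)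
    (hD2H0 : ∀ n, HasMaj (bB n) (b3 n) ((D2 n ∘L H₀ n).restrictScalars ℝ : 𝒳 n →ₗ[ℝ] 𝒵 n)
      (fun y y' => cΔ * Real.exp (-(δ₀ * (gn n).dist y y'))))
    (hH0 : ∀ n, HasMaj (bB n) (bN n) ((H₀ n).restrictScalars ℝ : 𝒳 n →ₗ[ℝ] 𝒴 n)
      (fun y y' => A₀ * Real.exp (-(δ₀ * (gn n).dist y y'))))
    (hH0₂ : ∀ n i, HasMaj (bB n) (bout n i) ((H₀ n).restrictScalars ℝ : 𝒳 n →ₗ[ℝ] 𝒴 n)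
      (fun y y' => A₀₂ * Real.exp (-(δ₀ * (gn n).dist y y'))))
    (hH₂ : ∀ n i, HasMaj (bB n) (bout n i) ((H n).restrictScalars ℝ : 𝒳 n →ₗ[ℝ] 𝒴 n)
      (fun y y' => AH₂ * Real.exp (-(δ₀ / 2 * (gn n).dist y y'))))
    (hDfr : ∀ n, HasMaj (bN n) (bB n) ((𝔇 n).restrictScalars ℝ : 𝒴 n →ₗ[ℝ] 𝒳 n)
      (fun y y' => θD * Real.exp (-(δ₀ / 2 * (gn n).dist y y'))))
    (hqG : qG κ₃ κN BG θW q.cR < 1)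
    (hCst : (κ₃ * BG₂ * (cΔ + κN * θW * (A₀ + constA0 κ₃ κN BG θW cΔ A₀ q.cR) * q.cR) * q.cR + A₀₂) +
        q.κB * AH₂ * (κN * θD * (constA0 κ₃ κN BG θW cΔ A₀ q.cR + A₀) * q.cR) * q.cR ≤ q.Cst)
    (hδ15 : q.δ15 ≤ δ₀)
    (hdom : ∀ n, NormDominated (S := tsys 4 (N n)) (bout n) (blk n) (V := fun _ => Wn n) (ι n))
    (hm : ∀ n x y', (bB n).loc y' (u n x) ≤ q.m)
    (hD' : ∀ n, UnitFieldsLocalised (bB n) (geomT 4 (N n) M) (blk n) (u n) q.θ)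
    -- NODE E: (1.7)-factorization, test-vector convergence for THESE test vectors, read-out
    (Vsp : LDom 4 → Type) [instV : ∀ Y, NormedAddCommGroup (Vsp Y)] [instVs : ∀ Y, NormedSpace ℂ (Vsp Y)]
    (F : (Y : LDom 4) → Vsp Y → ℂ) (hFd : ∀ Y, ∃ ρ > 0, DifferentiableOn ℂ (F Y) (ball 0 ρ))
    (r : (n : ℕ) → (Y : LDom 4) → Wn n →L[ℂ] Vsp Y)
    (hfac : ∀ Y : LDom 4, ∀ᶠ n in atTop, ∀ v ∈ ball (0 : Wn n) α₂,
      (stepObjectOfActivities (Φ n) (dat n) (act n) (V n)).E (tproj (N n) Y) (s n (tproj (N n) Y) v) = F Y (r n Y v))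
    (t : (Y : LDom 4) → Pt 4 → Vsp Y)
    (hconv : ∀ (Y : LDom 4) (x : Pt 4),
      Tendsto (fun n => r n Y (ι n (tproj (N n) Y)
        (((fderiv ℂ (chartH179 (𝒢 n) (Wv n) (D2 n) (H₀ n) (fun Y' : 𝒴 n => Y' - H n (Dm n Y')) (ε₄ n))
          (B n)).restrictScalars ℝ : 𝒳 n →ₗ[ℝ] 𝒴 n) (u n (proj (N n * M) x))))) atTop (𝓝 (t Y x)))
    (a : LDom 4 → Pt 4 → ℝ) (ha : ∀ (Y : LDom 4) (z : Pt 4), a Y z = (mixedDeriv (F Y) (t Y 0) (t Y z)).re)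
    (hβ1 : Sβ.β1 k p = B12Beta.secondMoment (fun _ _ => limKernel a) μ ν)
    (hC : CondsL 4 c ℓ) (h22 : c.R22gen ℓ) (hq : q.Valid c.δ₀) (hsg : SignsL c α₂ q.B₃) :
    |Sβ.β1 k p| ≤ c.ε₁ * remCoeffL 4 M c α₂ q.B₃ :=
  abs_beta1_le_of_activities_at N hNlim Φ dat act V hmaj hhol Wn s hs hmaps
    { I := I, gn := gn, FBn := 𝒳, FAn := 𝒴, bBn := bB, boutn := bout,
      dHn := fun n => ((fderiv ℂ (chartH179 (𝒢 n) (Wv n) (D2 n) (H₀ n) (fun Y' : 𝒴 n => Y' - H n (Dm n Y')) (ε₄ n))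
        (B n)).restrictScalars ℝ : 𝒳 n →ₗ[ℝ] 𝒴 n),
      blkn := blk, ιn := ι, un := u,
      h190 := h190_of_sectG_actual 𝒢 Wv D2 H₀ H Dm 𝔇 B₀ θ C₄ a₃ jR aR ε₄ B R hWa hJ h𝔄 hD bB bN b3 bout hNsz hBloc htri hd
        hδ₀ hrow hσ hBG hBG₂ hθW hcΔ hA₀ hA₀₂ hAH₂ hθD hκB hκN hκ₃ hG hG₂ h189 hD2H0 hH0 hH0₂ hH₂ hDfr hqG hCst hδ15,
      hdist := hd, hrow := hrow, hκB := hκB, hdom := hdom, hm := hm, hD := hD' }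
    Vsp F hFd r hfac t hconv a ha hβ1 hC h22 hq hsg

end Summit.QuantumFields.BalabanUV.Beta.RemainderEndActivitiesSectG
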